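import Mathlib
import Summits.NavierStokesRegularity.NavierStokesRegularity.Theorems.WakeRatchetTailRatchetFiringClock
import HarnessLib

/-!
# `WakeRatchet.TailRatchet` (stmt-NavierStokesRegularity-21808), door D4′ — FIRST FIRINGS of a quiet-start
# half-line solution of the renormalised dyadic lattice under post-firing decay (D′)

Def-free support lemmas (MODEL lattice ODEs: the scalar dyadic member of Tao 2016 §1.2 / §4 in the renormalised
variables of §6.4; nothing here concerns the Navier–Stokes equations; stmt-21808 is neither proved nor refuted here
and no stub of skeleton d00b85951d7c is closed).

SETTING (hypotheses stated explicitly in every lemma): a scalar family `W : ℤ → ℝ → ℝ` solving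
`W_n' = −W_n + Λ W_{n−1}² − Λ⁻¹ W_n W_{n+1}` on `σ > A₀`, with `0 ≤ W_n(σ)` for `σ ≥ A > A₀`, QUIET START
(`W_n ≡ 0` for `n < 0`, `W_n(A) = 0` for `n > 0`), a LOWER RATE at level `c > 0` («some shell has `W_n(σ) ≥ c` at
every `σ ≥ A`», `Λc ≤ 1`), and the POST-FIRING DECAY (D′) `W_n(σ₁) ≥ c, A ≤ σ₁ ≤ σ₂ ⟹ W_n(σ₂) ≤ D e^{−(σ₂−σ₁)}`.
The intended instance is the renormalised one-shell non-negative dyadic Cauchy blow-up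
(`WakeRatchetDyadicCauchy.dyadic_blowup_typeI`), for which everything but (D′) is in the tree.

CONTENT: firing order (`exists_fired_pred`, from the tree's `lt_level_of_feed_sq_le`), every shell `n ≥ 0` fires
(`firingSet_nonempty_le`), first firing log-times exist and are attained (`exists_firstFiring`), are monotone
(`firstFiring_mono`), obey the covering property and the GAP BOUND `s (j+K) ≤ s j + K·log(D/c)`
(`firstFiring_cover`, `firstFiring_gap_le`, tree `firing_gap_le`), and tend to `+∞` (`firstFiring_tendsto_atTop`).
Used by `WakeRatchetTailRatchetPostFiringAction` and `WakeRatchetTailRatchet/Negative/TailRatchetFalseOfDyadicPostFiringDecay`.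

HONEST FRAMING: elementary real analysis on a MODEL lattice; the estimate (D′) is a HYPOTHESIS here; rung 0.
-/

noncomputable section

set_option linter.dupNamespace false

namespace Summit.NavierStokesRegularity.NavierStokesRegularity.Theorems

namespace WakeRatchetDyadicPostFiring

open Set Filter Topology MeasureTheory intervalIntegral
open WakeRatchetFiringClock

variable {Λ : ℝ} {W : ℤ → ℝ → ℝ} {A₀ A B c D : ℝ}

/-! ## Continuity and integrability on the half-line -/

/-- A solution of the renormalised lattice on `σ > A₀` is continuous there.
[cite: Tao2016AveragedNS, §4 Lemma 4.1 (4.8) in the self-similar variables of §6.4; elementary] -/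
theorem continuousOn_Ioi
    (hlaw : ∀ (n : ℤ) (σ : ℝ), A₀ < σ → HasDerivAt (W n)
      (-(W n σ) + Λ * W (n - 1) σ ^ 2 - Λ⁻¹ * W n σ * W (n + 1) σ) σ) (n : ℤ) :
    ContinuousOn (W n) (Ioi A₀) := fun σ hσ => (hlaw n σ hσ).continuousAt.continuousWithinAt

/-- Continuity on closed intervals inside the half-line.
[cite: Tao2016AveragedNS, §4 Lemma 4.1 (4.8), §6.4; elementary] -/
theorem continuousOn_Icc
    (hlaw : ∀ (n : ℤ) (σ : ℝ), A₀ < σ → HasDerivAt (W n)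
      (-(W n σ) + Λ * W (n - 1) σ ^ 2 - Λ⁻¹ * W n σ * W (n + 1) σ) σ) (n : ℤ) {a b : ℝ} (ha : A₀ < a) :
    ContinuousOn (W n) (Icc a b) :=
  (continuousOn_Ioi hlaw n).mono fun _ hσ => ha.trans_le hσ.1

/-- Interval integrability inside the half-line.
[cite: Tao2016AveragedNS, §4 Lemma 4.1 (4.8), §6.4; elementary] -/
theorem intervalIntegrable_W
    (hlaw : ∀ (n : ℤ) (σ : ℝ), A₀ < σ → HasDerivAt (W n)
      (-(W n σ) + Λ * W (n - 1) σ ^ 2 - Λ⁻¹ * W n σ * W (n + 1) σ) σ) (n : ℤ) {a b : ℝ} (ha : A₀ < a)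
    (hb : A₀ < b) : IntervalIntegrable (W n) volume a b :=
  ((continuousOn_Ioi hlaw n).mono fun _ hx => (lt_min ha hb).trans_le hx.1).intervalIntegrable

/-- Interval integrability of the square inside the half-line.
[cite: Tao2016AveragedNS, §4 Lemma 4.1 (4.8), §6.4; elementary] -/
theorem intervalIntegrable_W_sq
    (hlaw : ∀ (n : ℤ) (σ : ℝ), A₀ < σ → HasDerivAt (W n)
      (-(W n σ) + Λ * W (n - 1) σ ^ 2 - Λ⁻¹ * W n σ * W (n + 1) σ) σ) (n : ℤ) {a b : ℝ} (ha : A₀ < a)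
    (hb : A₀ < b) : IntervalIntegrable (fun u => W n u ^ 2) volume a b :=
  (((continuousOn_Ioi hlaw n).pow 2).mono fun _ hx => (lt_min ha hb).trans_le hx.1).intervalIntegrable

/-- FTC: the running integral `σ ↦ ∫_A^σ f` of a function continuous on `σ > A₀` (`A₀ < A`) has derivative `f`.
[folklore (fundamental theorem of calculus)] -/
theorem hasDerivAt_runningIntegral {f : ℝ → ℝ} (hf : ContinuousOn f (Ioi A₀)) (hA : A₀ < A) {σ : ℝ}
    (hσ : A₀ < σ) : HasDerivAt (fun u => ∫ x in A..u, f x) (f σ) σ := by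
  have hint : IntervalIntegrable f volume A σ :=
    (hf.mono fun _ hx => (lt_min hA hσ).trans_le hx.1).intervalIntegrable
  exact intervalIntegral.integral_hasDerivAt_right hint
    (ContinuousOn.stronglyMeasurableAtFilter isOpen_Ioi hf σ hσ) (hf.continuousAt (Ioi_mem_nhds hσ))

/-! ## Firing order: shell `k+1` reaches the level `c` only after shell `k` -/

/-- **Firing order (one step).**  Quiet start (`W (k+1) A = 0`), non-negativity and `Λc ≤ 1`: if shell `k+1`
(`k ≥ 0`) is at level `≥ c` at `b ≥ A`, shell `k` exceeded `c` strictly before `b`.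
[cite: Tao2016AveragedNS, §1.2 (dyadic model), §4 Lemma 4.1 (4.8), §6.4; elementary (tree `lt_level_of_feed_sq_le`)] -/
theorem exists_fired_pred (hΛ : 0 < Λ) (hA : A₀ < A) (hc : 0 < c) (hΛc : Λ * c ≤ 1)
    (hlaw : ∀ (n : ℤ) (σ : ℝ), A₀ < σ → HasDerivAt (W n)
      (-(W n σ) + Λ * W (n - 1) σ ^ 2 - Λ⁻¹ * W n σ * W (n + 1) σ) σ)
    (hnn : ∀ (n : ℤ) (σ : ℝ), A ≤ σ → 0 ≤ W n σ) (hstart : ∀ n : ℤ, 0 < n → W n A = 0)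
    {k : ℤ} (hk : 0 ≤ k) {b : ℝ} (hb : A ≤ b) (hfire : c ≤ W (k + 1) b) :
    ∃ σ : ℝ, A ≤ σ ∧ σ < b ∧ c < W k σ := by
  by_contra h
  push Not at h
  have hv : ∀ σ ∈ Ico A b, HasDerivAt (W (k + 1))
      (-(W (k + 1) σ) + Λ * W k σ ^ 2 - Λ⁻¹ * W (k + 1) σ * W (k + 1 + 1) σ) σ := by
    intro σ hσ
    have := hlaw (k + 1) σ (hA.trans_le hσ.1)
    rwa [add_sub_cancel_right] at this
  have hvc : ContinuousOn (W (k + 1)) (Icc A b) := continuousOn_Icc hlaw (k + 1) hA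
  have hv0 : ∀ σ ∈ Icc A b, 0 ≤ W (k + 1) σ := fun σ hσ => hnn _ σ hσ.1
  have hz0 : ∀ σ ∈ Icc A b, 0 ≤ W (k + 1 + 1) σ := fun σ hσ => hnn _ σ hσ.1
  have hu : ∀ σ ∈ Ico A b, W k σ ^ 2 ≤ c ^ 2 := fun σ hσ =>
    pow_le_pow_left₀ (hnn k σ hσ.1) (h σ hσ.1 hσ.2) 2
  have hinit : W (k + 1) A < Λ * c ^ 2 := by
    rw [hstart (k + 1) (by omega)]
    positivity
  have hlt := lt_level_of_feed_sq_le hΛ hv hvc hv0 hz0 hu hinit b (right_mem_Icc.2 hb)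
  have hle : Λ * c ^ 2 ≤ c := level_le_of_mul_le_one hc.le hΛc
  linarith

/-- **Firing order (iterated).**  If shell `k + d` is at level `≥ c` at `b ≥ A`, shell `k` was at level `≥ c` at
some log-time in `[A, b]`.
[cite: Tao2016AveragedNS, §1.2, §4 Lemma 4.1 (4.8), §6.4; elementary induction] -/
theorem exists_fired_below (hΛ : 0 < Λ) (hA : A₀ < A) (hc : 0 < c) (hΛc : Λ * c ≤ 1)
    (hlaw : ∀ (n : ℤ) (σ : ℝ), A₀ < σ → HasDerivAt (W n)
      (-(W n σ) + Λ * W (n - 1) σ ^ 2 - Λ⁻¹ * W n σ * W (n + 1) σ) σ)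
    (hnn : ∀ (n : ℤ) (σ : ℝ), A ≤ σ → 0 ≤ W n σ) (hstart : ∀ n : ℤ, 0 < n → W n A = 0)
    (k d : ℕ) {b : ℝ} (hb : A ≤ b) (hfire : c ≤ W ((k + d : ℕ) : ℤ) b) :
    ∃ σ : ℝ, A ≤ σ ∧ σ ≤ b ∧ c ≤ W (k : ℤ) σ := by
  induction d generalizing b with
  | zero => exact ⟨b, hb, le_rfl, by simpa using hfire⟩
  | succ d ih =>
    have hfire' : c ≤ W (((k + d : ℕ) : ℤ) + 1) b := by
      have hcast : ((k + (d + 1) : ℕ) : ℤ) = ((k + d : ℕ) : ℤ) + 1 := by push_cast; ring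
      rwa [hcast] at hfire
    obtain ⟨σ, hσA, hσb, hσc⟩ :=
      exists_fired_pred hΛ hA hc hΛc hlaw hnn hstart (Int.natCast_nonneg _) hb hfire'
    obtain ⟨τ, hτA, hτσ, hτc⟩ := ih hσA hσc.le
    exact ⟨τ, hτA, hτσ.trans hσb.le, hτc⟩

/-! ## Firing sets and their infima -/

/-- The firing set `{σ ≥ A : W n σ ≥ c}` is closed (continuity on the half-line).
[cite: Tao2016AveragedNS, §6.4 (self-similar log-time); elementary] -/
theorem isClosed_firingSet (hA : A₀ < A)
    (hlaw : ∀ (n : ℤ) (σ : ℝ), A₀ < σ → HasDerivAt (W n)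
      (-(W n σ) + Λ * W (n - 1) σ ^ 2 - Λ⁻¹ * W n σ * W (n + 1) σ) σ) (n : ℤ) :
    IsClosed {σ : ℝ | A ≤ σ ∧ c ≤ W n σ} := by
  have h : {σ : ℝ | A ≤ σ ∧ c ≤ W n σ} = Ici A ∩ W n ⁻¹' Ici c := by
    ext σ; simp only [mem_setOf_eq, mem_inter_iff, mem_Ici, mem_preimage]
  rw [h]
  exact ContinuousOn.preimage_isClosed_of_isClosed
    ((continuousOn_Ioi hlaw n).mono fun σ hσ => hA.trans_le hσ) isClosed_Ici isClosed_Ici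

/-- The firing set is bounded below by `A`. [elementary] -/
theorem bddBelow_firingSet (n : ℤ) : BddBelow {σ : ℝ | A ≤ σ ∧ c ≤ W n σ} :=
  ⟨A, fun _ hσ => hσ.1⟩

/-- A firing log-time bounds the infimum of the firing set from above. [elementary] -/
theorem sInf_firingSet_le (n : ℤ) {σ : ℝ} (hσ : A ≤ σ) (h : c ≤ W n σ) :
    sInf {σ : ℝ | A ≤ σ ∧ c ≤ W n σ} ≤ σ :=
  csInf_le (bddBelow_firingSet n) ⟨hσ, h⟩

/-- A shell at level `≥ c` after `A` has a non-negative index (negative shells vanish). [elementary] -/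
theorem nonneg_of_fire (hc : 0 < c) (hneg : ∀ n : ℤ, n < 0 → ∀ σ : ℝ, A ≤ σ → W n σ = 0)
    {m : ℤ} {σ : ℝ} (hσ : A ≤ σ) (h : c ≤ W m σ) : 0 ≤ m := by
  by_contra h'
  rw [hneg m (not_le.1 h') σ hσ] at h
  linarith

/-- Quiet start + lower rate: shell `0` is at level `≥ c` at the initial log-time `A`.
[cite: Tao2016AveragedNS, §1.2 (one-shell datum); elementary] -/
theorem fire_zero_initial (hc : 0 < c) (hneg : ∀ n : ℤ, n < 0 → ∀ σ : ℝ, A ≤ σ → W n σ = 0)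
    (hstart : ∀ n : ℤ, 0 < n → W n A = 0) (hrate : ∀ σ : ℝ, A ≤ σ → ∃ n : ℤ, c ≤ W n σ) :
    c ≤ W 0 A := by
  obtain ⟨m, hm⟩ := hrate A le_rfl
  rcases lt_trichotomy m 0 with h | h | h
  · rw [hneg m h A le_rfl] at hm; linarith
  · rwa [h] at hm
  · rw [hstart m h] at hm; linarith

/-- The decay constant dominates the firing level: `c ≤ D` (hence `D > 0`, `log(D/c) ≥ 0`). [elementary] -/
theorem level_le_D (hc : 0 < c) (hneg : ∀ n : ℤ, n < 0 → ∀ σ : ℝ, A ≤ σ → W n σ = 0)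
    (hstart : ∀ n : ℤ, 0 < n → W n A = 0) (hrate : ∀ σ : ℝ, A ≤ σ → ∃ n : ℤ, c ≤ W n σ)
    (hdec : ∀ (n : ℤ) (σ₁ σ₂ : ℝ), A ≤ σ₁ → σ₁ ≤ σ₂ → c ≤ W n σ₁ →
      W n σ₂ ≤ D * Real.exp (-(σ₂ - σ₁))) : c ≤ D := by
  have h0 := fire_zero_initial hc hneg hstart hrate
  have h1 := hdec 0 A A le_rfl le_rfl h0
  rw [sub_self, neg_zero, Real.exp_zero, mul_one] at h1
  exact h0.trans h1

/-- **Quiet after firing.**  (D′): a shell at level `≥ c` at `σ₁ ≥ A` is STRICTLY below `c` at every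
`σ > σ₁ + log(D/c)`.
[cite: Tao2016AveragedNS, §6.4; elementary] -/
theorem lt_level_of_decay (hc : 0 < c) (hcD : c ≤ D)
    (hdec : ∀ (n : ℤ) (σ₁ σ₂ : ℝ), A ≤ σ₁ → σ₁ ≤ σ₂ → c ≤ W n σ₁ →
      W n σ₂ ≤ D * Real.exp (-(σ₂ - σ₁)))
    (n : ℤ) {σ₁ σ : ℝ} (hσ₁ : A ≤ σ₁) (hfire : c ≤ W n σ₁) (hσ : σ₁ + Real.log (D / c) < σ) :
    W n σ < c := by
  have hD : 0 < D := hc.trans_le hcD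
  have hlog : 0 ≤ Real.log (D / c) := Real.log_nonneg ((one_le_div hc).2 hcD)
  have h1 := hdec n σ₁ σ hσ₁ (by linarith) hfire
  calc W n σ ≤ D * Real.exp (-(σ - σ₁)) := h1
    _ < D * Real.exp (-Real.log (D / c)) := by
        gcongr
        linarith
    _ = c := by
        rw [Real.exp_neg, Real.exp_log (div_pos hD hc)]
        field_simp

/-! ## Every shell fires: the firing sets are non-empty -/

/-- **Every shell `n ≥ 0` reaches the level `c`.**  (Induction: with shells `0..N` firing, at a log-time later than
all their first firings `+ log(D/c) + 1` they are quiet by (D′), negative shells vanish, so the active shell given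
by the lower rate has index `> N`, and by the firing order shell `N+1` fired.)
[cite: Tao2016AveragedNS, §1.2, §4 Lemma 4.1 (4.8), §6.4; elementary] -/
theorem firingSet_nonempty_le (hΛ : 0 < Λ) (hA : A₀ < A) (hc : 0 < c) (hΛc : Λ * c ≤ 1)
    (hlaw : ∀ (n : ℤ) (σ : ℝ), A₀ < σ → HasDerivAt (W n)
      (-(W n σ) + Λ * W (n - 1) σ ^ 2 - Λ⁻¹ * W n σ * W (n + 1) σ) σ)
    (hnn : ∀ (n : ℤ) (σ : ℝ), A ≤ σ → 0 ≤ W n σ)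
    (hneg : ∀ n : ℤ, n < 0 → ∀ σ : ℝ, A ≤ σ → W n σ = 0) (hstart : ∀ n : ℤ, 0 < n → W n A = 0)
    (hrate : ∀ σ : ℝ, A ≤ σ → ∃ n : ℤ, c ≤ W n σ)
    (hdec : ∀ (n : ℤ) (σ₁ σ₂ : ℝ), A ≤ σ₁ → σ₁ ≤ σ₂ → c ≤ W n σ₁ →
      W n σ₂ ≤ D * Real.exp (-(σ₂ - σ₁))) :
    ∀ N k : ℕ, k ≤ N → {σ : ℝ | A ≤ σ ∧ c ≤ W (k : ℤ) σ}.Nonempty := by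
  have hcD : c ≤ D := level_le_D hc hneg hstart hrate hdec
  intro N
  induction N with
  | zero =>
    intro k hk
    obtain rfl : k = 0 := Nat.le_zero.1 hk
    exact ⟨A, le_rfl, by simpa using fire_zero_initial hc hneg hstart hrate⟩
  | succ N ih =>
    intro k hk
    rcases Nat.lt_or_ge k (N + 1) with hlt | hge
    · exact ih k (Nat.lt_succ_iff.1 hlt)
    · obtain rfl : k = N + 1 := le_antisymm hk hge
      -- an upper bound `T` on the first firings of shells `0..N`
      obtain ⟨T, hT⟩ : ∃ T : ℝ, ∀ i : ℕ, i ≤ N → sInf {σ : ℝ | A ≤ σ ∧ c ≤ W (i : ℤ) σ} ≤ T := by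
        refine ⟨∑ i ∈ Finset.range (N + 1), |sInf {σ : ℝ | A ≤ σ ∧ c ≤ W (i : ℤ) σ}|, fun i hi => ?_⟩
        exact (le_abs_self _).trans (Finset.single_le_sum
          (f := fun i : ℕ => |sInf {σ : ℝ | A ≤ σ ∧ c ≤ W (i : ℤ) σ}|) (fun j _ => abs_nonneg _)
          (Finset.mem_range.2 (Nat.lt_succ_of_le hi)))
      set σ : ℝ := max A (T + Real.log (D / c) + 1) with hσdef
      have hσA : A ≤ σ := le_max_left _ _
      obtain ⟨m, hm⟩ := hrate σ hσA
      obtain ⟨m', rfl⟩ : ∃ m' : ℕ, (m' : ℤ) = m :=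
        ⟨m.toNat, Int.toNat_of_nonneg (nonneg_of_fire hc hneg hσA hm)⟩
      have hm'N : N + 1 ≤ m' := by
        by_contra hlt
        have hle : m' ≤ N := by omega
        obtain ⟨hs1, hs2⟩ := (isClosed_firingSet hA hlaw (m' : ℤ)).csInf_mem (ih m' hle)
          (bddBelow_firingSet (m' : ℤ))
        have hq := lt_level_of_decay hc hcD hdec (m' : ℤ) hs1 hs2 (σ := σ) (by
          have h1 := hT m' hle
          have h2 : T + Real.log (D / c) + 1 ≤ σ := le_max_right _ _
          linarith)
        linarith
      obtain ⟨d, hd⟩ : ∃ d : ℕ, m' = (N + 1) + d := ⟨m' - (N + 1), by omega⟩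
      subst hd
      obtain ⟨τ, hτA, -, hτc⟩ := exists_fired_below hΛ hA hc hΛc hlaw hnn hstart (N + 1) d hσA hm
      exact ⟨τ, hτA, hτc⟩

/-- **First firing log-times.**  There is `s : ℕ → ℝ` with `A ≤ s n`, `W n (s n) ≥ c`, and minimality:
`W n σ ≥ c`, `σ ≥ A` ⟹ `s n ≤ σ`.
[cite: Tao2016AveragedNS, §6.4; elementary (infimum of a closed bounded-below non-empty set)] -/
theorem exists_firstFiring (hΛ : 0 < Λ) (hA : A₀ < A) (hc : 0 < c) (hΛc : Λ * c ≤ 1)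
    (hlaw : ∀ (n : ℤ) (σ : ℝ), A₀ < σ → HasDerivAt (W n)
      (-(W n σ) + Λ * W (n - 1) σ ^ 2 - Λ⁻¹ * W n σ * W (n + 1) σ) σ)
    (hnn : ∀ (n : ℤ) (σ : ℝ), A ≤ σ → 0 ≤ W n σ)
    (hneg : ∀ n : ℤ, n < 0 → ∀ σ : ℝ, A ≤ σ → W n σ = 0) (hstart : ∀ n : ℤ, 0 < n → W n A = 0)
    (hrate : ∀ σ : ℝ, A ≤ σ → ∃ n : ℤ, c ≤ W n σ)
    (hdec : ∀ (n : ℤ) (σ₁ σ₂ : ℝ), A ≤ σ₁ → σ₁ ≤ σ₂ → c ≤ W n σ₁ →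
      W n σ₂ ≤ D * Real.exp (-(σ₂ - σ₁))) :
    ∃ s : ℕ → ℝ, (∀ n : ℕ, A ≤ s n) ∧ (∀ n : ℕ, c ≤ W n (s n)) ∧
      (∀ (n : ℕ) (σ : ℝ), A ≤ σ → c ≤ W (n : ℤ) σ → s n ≤ σ) := by
  refine ⟨fun n => sInf {σ : ℝ | A ≤ σ ∧ c ≤ W (n : ℤ) σ}, fun n => ?_, fun n => ?_,
    fun n σ hσ h => sInf_firingSet_le (n : ℤ) hσ h⟩
  · exact ((isClosed_firingSet hA hlaw (n : ℤ)).csInf_mem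
      (firingSet_nonempty_le hΛ hA hc hΛc hlaw hnn hneg hstart hrate hdec n n le_rfl)
      (bddBelow_firingSet (n : ℤ))).1
  · exact ((isClosed_firingSet hA hlaw (n : ℤ)).csInf_mem
      (firingSet_nonempty_le hΛ hA hc hΛc hlaw hnn hneg hstart hrate hdec n n le_rfl)
      (bddBelow_firingSet (n : ℤ))).2

/-! ## Properties of first firing log-times `s` (abstractly: `A ≤ s n`, `W n (s n) ≥ c`, minimality) -/

/-- Shells are strictly below `c` before their first firing. [elementary] -/
theorem lt_level_before {s : ℕ → ℝ}
    (hs3 : ∀ (n : ℕ) (σ : ℝ), A ≤ σ → c ≤ W (n : ℤ) σ → s n ≤ σ)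
    (n : ℕ) {σ : ℝ} (hσ : A ≤ σ) (h : σ < s n) : W (n : ℤ) σ < c := by
  by_contra h'
  exact absurd (hs3 n σ hσ (not_lt.1 h')) (not_le.2 h)

/-- The first firing of shell `0` is the initial log-time. [elementary] -/
theorem firstFiring_zero (hc : 0 < c) (hneg : ∀ n : ℤ, n < 0 → ∀ σ : ℝ, A ≤ σ → W n σ = 0)
    (hstart : ∀ n : ℤ, 0 < n → W n A = 0) (hrate : ∀ σ : ℝ, A ≤ σ → ∃ n : ℤ, c ≤ W n σ)
    {s : ℕ → ℝ} (hs1 : ∀ n : ℕ, A ≤ s n)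
    (hs3 : ∀ (n : ℕ) (σ : ℝ), A ≤ σ → c ≤ W (n : ℤ) σ → s n ≤ σ) : s 0 = A :=
  le_antisymm (hs3 0 A le_rfl (by simpa using fire_zero_initial hc hneg hstart hrate)) (hs1 0)

/-- **First firings are monotone** (firing order). [cite: Tao2016AveragedNS, §1.2, §4 (4.8), §6.4; elementary] -/
theorem firstFiring_mono (hΛ : 0 < Λ) (hA : A₀ < A) (hc : 0 < c) (hΛc : Λ * c ≤ 1)
    (hlaw : ∀ (n : ℤ) (σ : ℝ), A₀ < σ → HasDerivAt (W n)
      (-(W n σ) + Λ * W (n - 1) σ ^ 2 - Λ⁻¹ * W n σ * W (n + 1) σ) σ)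
    (hnn : ∀ (n : ℤ) (σ : ℝ), A ≤ σ → 0 ≤ W n σ) (hstart : ∀ n : ℤ, 0 < n → W n A = 0)
    {s : ℕ → ℝ} (hs1 : ∀ n : ℕ, A ≤ s n) (hs2 : ∀ n : ℕ, c ≤ W n (s n))
    (hs3 : ∀ (n : ℕ) (σ : ℝ), A ≤ σ → c ≤ W (n : ℤ) σ → s n ≤ σ) : Monotone s := by
  refine monotone_nat_of_le_succ fun n => ?_
  have hfire : c ≤ W ((n : ℤ) + 1) (s (n + 1)) := by
    have := hs2 (n + 1); push_cast at this; exact this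
  obtain ⟨σ, hσA, hσlt, hσc⟩ :=
    exists_fired_pred hΛ hA hc hΛc hlaw hnn hstart (Int.natCast_nonneg n) (hs1 (n + 1)) hfire
  exact (hs3 n σ hσA hσc.le).trans hσlt.le

/-- **Post-firing decay from the first firing.** [cite: Tao2016AveragedNS, §6.4; hypothesis (D′)] -/
theorem decay_from_firstFiring
    (hdec : ∀ (n : ℤ) (σ₁ σ₂ : ℝ), A ≤ σ₁ → σ₁ ≤ σ₂ → c ≤ W n σ₁ →
      W n σ₂ ≤ D * Real.exp (-(σ₂ - σ₁)))
    {s : ℕ → ℝ} (hs1 : ∀ n : ℕ, A ≤ s n) (hs2 : ∀ n : ℕ, c ≤ W n (s n))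
    (n : ℕ) {σ : ℝ} (hσ : s n ≤ σ) : W (n : ℤ) σ ≤ D * Real.exp (-(σ - s n)) :=
  hdec (n : ℤ) (s n) σ (hs1 n) hσ (hs2 n)

/-- **Covering property.**  Every log-time strictly between `s j` and `s (j+1)` is within `log(D/c)` after the
first firing of some shell `n ≤ j` (lower rate + minimality + monotonicity + (D′)).
[cite: Tao2016AveragedNS, §6.4; elementary] -/
theorem firstFiring_cover (hc : 0 < c) (hneg : ∀ n : ℤ, n < 0 → ∀ σ : ℝ, A ≤ σ → W n σ = 0)
    (hrate : ∀ σ : ℝ, A ≤ σ → ∃ n : ℤ, c ≤ W n σ)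
    (hdec : ∀ (n : ℤ) (σ₁ σ₂ : ℝ), A ≤ σ₁ → σ₁ ≤ σ₂ → c ≤ W n σ₁ →
      W n σ₂ ≤ D * Real.exp (-(σ₂ - σ₁)))
    {s : ℕ → ℝ} (hs1 : ∀ n : ℕ, A ≤ s n) (hs2 : ∀ n : ℕ, c ≤ W n (s n))
    (hs3 : ∀ (n : ℕ) (σ : ℝ), A ≤ σ → c ≤ W (n : ℤ) σ → s n ≤ σ) (hmono : Monotone s) :
    ∀ (j : ℕ) (σ : ℝ), s j < σ → σ < s (j + 1) →
      ∃ n : ℕ, n ≤ j ∧ s n ≤ σ ∧ σ ≤ s n + Real.log (D / c) := by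
  intro j σ h1 h2
  have hσA : A ≤ σ := (hs1 j).trans h1.le
  obtain ⟨m, hm⟩ := hrate σ hσA
  obtain ⟨n, rfl⟩ : ∃ n : ℕ, (n : ℤ) = m :=
    ⟨m.toNat, Int.toNat_of_nonneg (nonneg_of_fire hc hneg hσA hm)⟩
  have hsn : s n ≤ σ := hs3 n σ hσA hm
  refine ⟨n, ?_, hsn, le_add_log_of_active hc hm (hdec n (s n) σ (hs1 n) hsn (hs2 n))⟩
  by_contra hnj
  have : s (j + 1) ≤ s n := hmono (by omega)
  linarith

/-- **Firing-gap bound** `s (j + K) ≤ s j + K·log(D/c)`. [cite: Tao2016AveragedNS, §6.4; tree `firing_gap_le`] -/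
theorem firstFiring_gap_le (hc : 0 < c) (hcD : c ≤ D)
    (hneg : ∀ n : ℤ, n < 0 → ∀ σ : ℝ, A ≤ σ → W n σ = 0)
    (hrate : ∀ σ : ℝ, A ≤ σ → ∃ n : ℤ, c ≤ W n σ)
    (hdec : ∀ (n : ℤ) (σ₁ σ₂ : ℝ), A ≤ σ₁ → σ₁ ≤ σ₂ → c ≤ W n σ₁ →
      W n σ₂ ≤ D * Real.exp (-(σ₂ - σ₁)))
    {s : ℕ → ℝ} (hs1 : ∀ n : ℕ, A ≤ s n) (hs2 : ∀ n : ℕ, c ≤ W n (s n))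
    (hs3 : ∀ (n : ℕ) (σ : ℝ), A ≤ σ → c ≤ W (n : ℤ) σ → s n ≤ σ) (hmono : Monotone s) :
    ∀ j K : ℕ, s (j + K) ≤ s j + K * Real.log (D / c) :=
  firing_gap_le hmono (Real.log_nonneg ((one_le_div hc).2 hcD))
    (firstFiring_cover hc hneg hrate hdec hs1 hs2 hs3 hmono)

/-- **First firings are unbounded**: `s n → ∞` (else all shells are eventually quiet, against the lower rate).
[cite: Tao2016AveragedNS, §6.4; elementary] -/
theorem firstFiring_tendsto_atTop (hc : 0 < c) (hcD : c ≤ D)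
    (hneg : ∀ n : ℤ, n < 0 → ∀ σ : ℝ, A ≤ σ → W n σ = 0)
    (hrate : ∀ σ : ℝ, A ≤ σ → ∃ n : ℤ, c ≤ W n σ)
    (hdec : ∀ (n : ℤ) (σ₁ σ₂ : ℝ), A ≤ σ₁ → σ₁ ≤ σ₂ → c ≤ W n σ₁ →
      W n σ₂ ≤ D * Real.exp (-(σ₂ - σ₁)))
    {s : ℕ → ℝ} (hs1 : ∀ n : ℕ, A ≤ s n) (hs2 : ∀ n : ℕ, c ≤ W n (s n)) (hmono : Monotone s) :
    Tendsto s atTop atTop := by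
  refine tendsto_atTop_atTop_of_monotone hmono fun S => ?_
  by_contra h
  push Not at h
  set σ : ℝ := max A (S + Real.log (D / c) + 1) with hσdef
  obtain ⟨m, hm⟩ := hrate σ (le_max_left _ _)
  obtain ⟨n, rfl⟩ : ∃ n : ℕ, (n : ℤ) = m :=
    ⟨m.toNat, Int.toNat_of_nonneg (nonneg_of_fire hc hneg (le_max_left _ _) hm)⟩
  have hq : W (n : ℤ) σ < c := lt_level_of_decay hc hcD hdec (n : ℤ) (hs1 n) (hs2 n) (by
    have h1 := h n
    have h2 : S + Real.log (D / c) + 1 ≤ σ := le_max_right _ _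
    linarith)
  linarith

end WakeRatchetDyadicPostFiring

end Summit.NavierStokesRegularity.NavierStokesRegularity.Theorems

end
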